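import Summits.Ventures.WeilGRH.DualCertificateAnnihilation
import HarnessLib

/-!
# Soundness of dual (Bochner-multiplier, "format-D") positivity certificates for the twisted Weil form

Cell `rh-explicit`, WEIL TRACK — GRH ARM (Lean root `Summits/Ventures/WeilGRH/`, namespace
`Summit.Ventures.WeilGRH`).  Vocabulary: `Literature/NumberTheory/LFunctions/WeilExplicitDirichlet.lean`
(`Q_χ(g) = weilQuadraticChar χ g = W_χ(g ⋆ g̃)`, rung predicate `WeilPositivityOnChar χ t`) and
`WeilFinitePrimeQuadraticChar.lean` (the analytic form on a finite-prime window,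
`Re Q_χ(g) = (1/2π) ∫ |ĝ(1/2+iτ)|² M_{χ,N}(τ) dτ` for `tsupport g ⊆ [-t, t]`, `e^{2t} ≤ N + 1`, with the
weight `M_{χ,N} = weilFinitePrimeWeightChar χ N`); atom annihilation from
`DualCertificateAnnihilation.lean`.  Everything here is PROVED (no named facts, no `sorry`); nothing is
claimed about zeros of `L(s, χ)`.

A FORMAT-D CERTIFICATE of the arm (weil-grh-3, `EXTREMALS/GRH/**/t-*-D/`, checker `ivcheck.py`) for a
rung `(q, χ, t)` is: a real `λ` and finitely many ATOMS
`A(τ) = c · τ^j · sinc(wτ/2)^m · cos(xτ)` or `c · τ^j · sinc(wτ/2)^m · sin(xτ)`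
(envelopes `pt, tri, sp4, sp6` = `m = 0, 2, 4, 6`; `w ≥ 0`; admissibility `x − m·w/2 ≥ 2t`), together
with a verified real inequality `P(τ) := M_{χ,N}(τ) − λ + Σ A(τ) ≥ 0` for all real `τ`.

## Results

* `WeilDualAtom` — the atom grammar as EXACT data (`c w x : ℚ`, `j m : ℕ`, `sine : Bool`, as in the
  certificate files), `eval` its real value, `reach = m·w/2`, and the decidable admissibility test
  `admissible A T = (0 ≤ w) && (T + reach ≤ x)` against a rational ceiling `T ≥ 2t` of the band edge
  (`RungLogBounds.lean` supplies `log n₀ ≤ ⌈log n₀⌉_{10⁻⁶}`); `integral_norm_sq_weilMellin_mul_eval_eq_zero` —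
  admissible atoms integrate to `0` against `|ĝ(1/2+iτ)|²`.
* `le_re_weilQuadraticChar_of_dual_nonneg` — **LEMMA D**: `χ` mod `q ≠ 1`, `e^{2t} ≤ N + 1`, `λ ∈ ℝ`,
  atoms `A_i` (`i ∈ s`) admissible for `t`, and `∀ τ, 0 ≤ M_{χ,N}(τ) − λ + Σ_i A_i(τ)` ⟹
  `λ ‖g‖₂² ≤ Re Q_χ(g)` for every test function `g` with `tsupport g ⊆ [-t, t]`
  (`Re Q_χ(g) − λ‖g‖₂² = (1/2π)∫|ĝ|²(M − λ) = (1/2π)∫|ĝ|² P ≥ 0`, the atoms integrating to `0`).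
  `weilPositivityOnChar_of_dual_nonneg` — with `λ ≥ 0` this is the rung `WeilPositivityOnChar χ t`.
  LIST forms `le_re_weilQuadraticChar_of_dual_nonneg_list` / `weilPositivityOnChar_of_dual_nonneg_list`
  (atoms as a `List WeilDualAtom`, admissibility `∀ A ∈ L, A.admissible T = true` decidable by `decide`,
  the dual function with `(L.map (·.eval τ)).sum`) are the entry points for instance files.
* `le_re_weilQuadraticChar_of_universal_dual_nonneg` / `weilPositivityOnChar_of_universal_dual_nonneg`
  — the arm's UNIVERSAL (archimedean-only) certificates of parity `a`: one inequality
  `∀ τ, 0 ≤ Re ψ(1/4 + a/2 + iτ/2) − log π − ℓ + Σ atoms` gives `(ℓ + log q)‖g‖₂² ≤ Re Q_χ(g)` for EVERY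
  `χ` mod `q ≠ 1` of parity `a` seeing no prime power `n ≤ N` (`weilFinitePrimeWeightChar_eq_arch`);
  `le_re_weilQuadraticChar_of_dual_nonneg_transfer` — transfer of a certificate inside a key group
  (same parity, same values at the prime powers `n ≤ N`: `M_{χ',N} = M_{χ,N} + log q' − log q`,
  `weilFinitePrimeWeightChar_transfer`).

So every verified format-D deposit `(λ ≥ 0, atoms, P ≥ 0)` is the theorem `WeilPositivityOnChar χ t`
MODULO the single real inequality `P ≥ 0` on `ℝ` (whose kernel proof — interval evaluation of `Re ψ` on
cells, as `ivcheck.py` does in 110-bit fixed point — is not in the tree).  Dictionary deposit → Lean: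
`t = (log n₀)/2 ↦ N = n₀ − 1` (for rational `t`: any `N` with `e^{2t} ≤ N + 1`; extra `n ≤ N` beyond
`e^{2t}` change `M_{χ,N}` but not the theorem), atom `(kind, env, j, w, x, c) ↦
⟨c, j, m(env), w, x, kind = sin⟩` with `m(pt, tri, sp4, sp6) = 0, 2, 4, 6` (all rational, verbatim); the checker's `M(τ)` is
`weilFinitePrimeWeightChar χ N τ` symbol for symbol (terms with `(n, q) > 1` vanish as `χ(n) = 0`);
the admissibility side conditions `log n₀ ≤ ⌈log n₀⌉_{10⁻⁶}` are `RungLogBounds.lean`.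
Design and soundness argument in prose: weil-grh-3, `run/shared/lean/pub/rh-explicit/weil-grh-3/GRH3-ROUTE.md`
§1 (LEMMA D), §1b (atom families), §4b (the Lean plan).

## References

* A. Weil, *Sur les "formules explicites" de la théorie des nombres premiers*, Comm. Sém. Math. Univ.
  Lund, tome suppl. (1952), 252–265 — (11), the «lemme» p. 262.
* M. G. Kreĭn, *Sur le problème du prolongement des fonctions hermitiennes positives et continues*,
  C. R. (Doklady) Acad. Sci. URSS 26 (1940), 17–22 (the duality behind multiplier certificates).
-/

noncomputable section

open Complex Filter Set MeasureTheory
open scoped Real Topology ComplexConjugate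

namespace Summit.Ventures.WeilGRH

open Literature.NumberTheory.LFunctions

variable {q : ℕ} {g : ℝ → ℂ}

/-! ## Format-D atoms (exact data) -/

/-- A **format-D atom** of the GRH arm's dual certificates, as exact data: the frequency-side function
`A(τ) = c · τ^j · sinc(wτ/2)^m · cos(xτ)` (`sine = false`) or `c · τ^j · sinc(wτ/2)^m · sin(xτ)`
(`sine = true`) with rational `c, w, x` — the cos/sin transform of `c` times (a `j`-th derivative of) the
`m`-fold box spline of step `w` centred at `x` (`m = 0`: point mass `pt`; `m = 2`: triangle `tri`;
`m = 4`: cubic B-spline `sp4`; `m = 6`: quintic B-spline `sp6`), supported in `[x − m·w/2, x + m·w/2]`.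
[folklore] -/
structure WeilDualAtom where
  /-- coefficient -/
  c : ℚ
  /-- power of `τ` (derivative order) -/
  j : ℕ
  /-- power of `sinc(wτ/2)` (box-spline order: `0, 2, 4, 6` = `pt, tri, sp4, sp6`) -/
  m : ℕ
  /-- step of the box spline (`w ≥ 0`) -/
  w : ℚ
  /-- centre on the position side -/
  x : ℚ
  /-- `sin(xτ)` (`true`) or `cos(xτ)` (`false`) -/
  sine : Bool

namespace WeilDualAtom

/-- The value `A(τ) = c · τ^j · sinc(wτ/2)^m · (cos | sin)(xτ)`. [folklore] -/
def eval (A : WeilDualAtom) (τ : ℝ) : ℝ :=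
  (A.c : ℝ) * (τ ^ A.j * Real.sinc ((A.w : ℝ) * τ / 2) ^ A.m *
    (if A.sine then Real.sin ((A.x : ℝ) * τ) else Real.cos ((A.x : ℝ) * τ)))

/-- The reach `m·w/2` of the atom (half-width of the position-side support around `x`). [folklore] -/
def reach (A : WeilDualAtom) : ℚ :=
  A.m * A.w / 2

/-- Decidable admissibility test against a rational ceiling `T` of the band edge `2t`:
`0 ≤ w` and `T + m·w/2 ≤ x`. [folklore] -/
def admissible (A : WeilDualAtom) (T : ℚ) : Bool :=
  decide (0 ≤ A.w) && decide (T + A.reach ≤ A.x)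

/-- Unfolding the admissibility test. [folklore] -/
theorem admissible_iff (A : WeilDualAtom) (T : ℚ) :
    A.admissible T = true ↔ 0 ≤ A.w ∧ T + A.m * A.w / 2 ≤ A.x := by
  simp [admissible, reach]

/-- The atom is continuous in `τ`. [folklore] -/
theorem continuous_eval (A : WeilDualAtom) : Continuous A.eval := by
  unfold eval
  refine continuous_const.mul ((((continuous_id.pow _).mul
    ((Real.continuous_sinc.comp (by fun_prop)).pow _))).mul ?_)
  split <;> fun_prop

/-- `|A(τ)| ≤ |c| · |τ|^j`. [folklore] -/
theorem abs_eval_le (A : WeilDualAtom) (τ : ℝ) : |A.eval τ| ≤ |(A.c : ℝ)| * |τ| ^ A.j := by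
  unfold eval
  rw [abs_mul, abs_mul, abs_mul, abs_pow, abs_pow]
  refine mul_le_mul_of_nonneg_left ?_ (abs_nonneg _)
  have h1 : |Real.sinc ((A.w : ℝ) * τ / 2)| ^ A.m ≤ 1 :=
    pow_le_one₀ (abs_nonneg _) (Real.abs_sinc_le_one _)
  have h2 : |(if A.sine then Real.sin ((A.x : ℝ) * τ) else Real.cos ((A.x : ℝ) * τ))| ≤ 1 := by
    split
    · exact Real.abs_sin_le_one _
    · exact Real.abs_cos_le_one _
  calc |τ| ^ A.j * |Real.sinc ((A.w : ℝ) * τ / 2)| ^ A.m *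
        |(if A.sine then Real.sin ((A.x : ℝ) * τ) else Real.cos ((A.x : ℝ) * τ))|
      ≤ |τ| ^ A.j * 1 * 1 := by gcongr
    _ = |τ| ^ A.j := by ring

end WeilDualAtom

/-- `τ ↦ |ĝ(1/2+iτ)|² A(τ)` is integrable for every atom (`|A| ≤ |c| |τ|^j` and
`integrable_norm_sq_weilMellin_mul_pow`). [folklore] -/
theorem integrable_norm_sq_weilMellin_mul_eval (hg : IsWeilTest g) (A : WeilDualAtom) :
    Integrable fun τ : ℝ ↦ ‖weilMellin g (1 / 2 + τ * I)‖ ^ 2 * A.eval τ := by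
  have h := (integrable_norm_sq_weilMellin_mul_pow hg A.j).norm.const_mul |(A.c : ℝ)|
  refine h.mono' (((continuous_norm_sq_weilMellin_half_line hg).mul A.continuous_eval).aestronglyMeasurable)
    (Eventually.of_forall fun τ ↦ ?_)
  simp only [Real.norm_eq_abs, abs_mul, abs_pow, abs_norm]
  have := A.abs_eval_le τ
  calc ‖weilMellin g (1 / 2 + τ * I)‖ ^ 2 * |A.eval τ|
      ≤ ‖weilMellin g (1 / 2 + τ * I)‖ ^ 2 * (|(A.c : ℝ)| * |τ| ^ A.j) :=
        mul_le_mul_of_nonneg_left this (by positivity)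
    _ = |(A.c : ℝ)| * (‖weilMellin g (1 / 2 + τ * I)‖ ^ 2 * |τ| ^ A.j) := by ring

/-- **An admissible atom is annihilated**: if `2t ≤ T` and `A.admissible T` (`w ≥ 0`, `x − m·w/2 ≥ T ≥ 2t`:
the position-side support lies in `[2t, ∞)`), then `∫ |ĝ(1/2+iτ)|² A(τ) dτ = 0` for every test function
`g` with `tsupport g ⊆ [-t, t]`. [folklore] -/
theorem integral_norm_sq_weilMellin_mul_eval_eq_zero (hg : IsWeilTest g) {t : ℝ}
    (hsupp : tsupport g ⊆ Icc (-t) t) {T : ℚ} (hT : 2 * t ≤ (T : ℝ)) {A : WeilDualAtom}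
    (hA : A.admissible T = true) :
    ∫ τ : ℝ, ‖weilMellin g (1 / 2 + τ * I)‖ ^ 2 * A.eval τ = 0 := by
  obtain ⟨hw, hx⟩ := (A.admissible_iff T).1 hA
  have hw' : (0 : ℝ) ≤ (A.w : ℝ) := by exact_mod_cast hw
  have hx' : (T : ℝ) + (A.m : ℝ) * (A.w : ℝ) / 2 ≤ (A.x : ℝ) := by exact_mod_cast hx
  have h := integral_norm_sq_weilMellin_mul_atom_eq_zero hg hsupp A.j A.m hw'
    (x := (A.x : ℝ)) (by linarith)
  unfold WeilDualAtom.eval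
  cases A.sine
  · simp only [Bool.false_eq_true, ↓reduceIte]
    have e : (fun τ : ℝ ↦ ‖weilMellin g (1 / 2 + τ * I)‖ ^ 2 *
        ((A.c : ℝ) * (τ ^ A.j * Real.sinc ((A.w : ℝ) * τ / 2) ^ A.m * Real.cos ((A.x : ℝ) * τ)))) =
        fun τ : ℝ ↦ (A.c : ℝ) * (‖weilMellin g (1 / 2 + τ * I)‖ ^ 2 *
          (τ ^ A.j * Real.sinc ((A.w : ℝ) * τ / 2) ^ A.m * Real.cos ((A.x : ℝ) * τ))) := by
      funext τ; ring
    rw [e, integral_const_mul, h.1, mul_zero]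
  · simp only [↓reduceIte]
    have e : (fun τ : ℝ ↦ ‖weilMellin g (1 / 2 + τ * I)‖ ^ 2 *
        ((A.c : ℝ) * (τ ^ A.j * Real.sinc ((A.w : ℝ) * τ / 2) ^ A.m * Real.sin ((A.x : ℝ) * τ)))) =
        fun τ : ℝ ↦ (A.c : ℝ) * (‖weilMellin g (1 / 2 + τ * I)‖ ^ 2 *
          (τ ^ A.j * Real.sinc ((A.w : ℝ) * τ / 2) ^ A.m * Real.sin ((A.x : ℝ) * τ))) := by
      funext τ; ring
    rw [e, integral_const_mul, h.2, mul_zero]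

/-! ## LEMMA D -/

/-- **LEMMA D (soundness of format-D dual certificates for the twisted Weil form).** Let `χ` be a
Dirichlet character mod `q ≠ 1`, `e^{2t} ≤ N + 1`, `2t ≤ T` (`T ∈ ℚ`), `λ ∈ ℝ`, and `A_i` (`i ∈ s`)
finitely many atoms admissible against `T`. If the dual function is nonnegative on the whole line,
`P(τ) := M_{χ,N}(τ) − λ + Σ_i A_i(τ) ≥ 0` for every real `τ`, then `λ ‖g‖₂² ≤ Re Q_χ(g)` for every test
function `g` with `tsupport g ⊆ [-t, t]`.
Proof: `Re Q_χ(g) − λ‖g‖₂² = (1/2π)∫|ĝ(1/2+iτ)|²(M_{χ,N}(τ) − λ)dτ` (analytic form + Plancherel)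
`= (1/2π)∫|ĝ|² P ≥ 0`, the atoms integrating to `0` against `|ĝ|²`. No zero of `L(s, χ)`, no GRH and no
finite section is used; `P ≥ 0` is the one real inequality a format-D deposit certifies. [folklore] -/
theorem le_re_weilQuadraticChar_of_dual_nonneg (hq : q ≠ 1) (χ : DirichletCharacter ℂ q)
    {t : ℝ} {N : ℕ} (hN : Real.exp (2 * t) ≤ (N : ℝ) + 1) {T : ℚ} (hT : 2 * t ≤ (T : ℝ)) (lam : ℝ)
    {ι : Type*} (s : Finset ι) (A : ι → WeilDualAtom) (hA : ∀ i ∈ s, (A i).admissible T = true)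
    (hP : ∀ τ : ℝ, 0 ≤ weilFinitePrimeWeightChar χ N τ - lam + ∑ i ∈ s, (A i).eval τ)
    (hg : IsWeilTest g) (hsupp : tsupport g ⊆ Icc (-t) t) :
    lam * weilNorm2Sq g ≤ (weilQuadraticChar χ g).re := by
  rw [weilQuadraticChar_re_eq_weilFinitePrimeQuadraticChar hq χ hg hN hsupp]
  unfold weilFinitePrimeQuadraticChar
  have hPl := integral_norm_sq_weilMellin_half_line hg
  have hM := integrable_norm_sq_weilMellin_mul_weilFinitePrimeWeightChar hg χ N
  have hL : Integrable fun τ : ℝ ↦ ‖weilMellin g (1 / 2 + τ * I)‖ ^ 2 * lam :=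
    (integrable_norm_sq_weilMellin_half_line hg).mul_const lam
  have hE : ∀ i ∈ s, Integrable fun τ : ℝ ↦ ‖weilMellin g (1 / 2 + τ * I)‖ ^ 2 * (A i).eval τ :=
    fun i _ ↦ integrable_norm_sq_weilMellin_mul_eval hg (A i)
  have hEs : Integrable fun τ : ℝ ↦ ∑ i ∈ s, ‖weilMellin g (1 / 2 + τ * I)‖ ^ 2 * (A i).eval τ :=
    integrable_finsetSum _ hE
  have hsum : ∫ τ : ℝ, ∑ i ∈ s, ‖weilMellin g (1 / 2 + τ * I)‖ ^ 2 * (A i).eval τ = 0 := by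
    rw [integral_finsetSum _ hE]
    exact Finset.sum_eq_zero fun i hi ↦
      integral_norm_sq_weilMellin_mul_eval_eq_zero hg hsupp hT (hA i hi)
  have hnonneg : 0 ≤ ∫ τ : ℝ, ‖weilMellin g (1 / 2 + τ * I)‖ ^ 2 *
      (weilFinitePrimeWeightChar χ N τ - lam + ∑ i ∈ s, (A i).eval τ) :=
    integral_nonneg fun τ ↦ mul_nonneg (by positivity) (hP τ)
  have hsplit : ∫ τ : ℝ, ‖weilMellin g (1 / 2 + τ * I)‖ ^ 2 *
      (weilFinitePrimeWeightChar χ N τ - lam + ∑ i ∈ s, (A i).eval τ) =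
      (∫ τ : ℝ, ‖weilMellin g (1 / 2 + τ * I)‖ ^ 2 * weilFinitePrimeWeightChar χ N τ) -
        (∫ τ : ℝ, ‖weilMellin g (1 / 2 + τ * I)‖ ^ 2 * lam) +
        ∫ τ : ℝ, ∑ i ∈ s, ‖weilMellin g (1 / 2 + τ * I)‖ ^ 2 * (A i).eval τ := by
    have hML : Integrable fun τ : ℝ ↦ ‖weilMellin g (1 / 2 + τ * I)‖ ^ 2 *
        weilFinitePrimeWeightChar χ N τ - ‖weilMellin g (1 / 2 + τ * I)‖ ^ 2 * lam := hM.sub hL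
    rw [← integral_sub hM hL, ← integral_add hML hEs]
    congr 1 with τ
    rw [mul_add, Finset.mul_sum]
    ring
  rw [hsplit, hsum, add_zero, integral_mul_const, hPl] at hnonneg
  have hπ : (0 : ℝ) < 2 * π := by positivity
  have key : lam * weilNorm2Sq g = 1 / (2 * π) * (2 * π * weilNorm2Sq g * lam) := by field_simp
  rw [key]
  exact mul_le_mul_of_nonneg_left (by linarith) (by positivity)

/-- **LEMMA D, rung form**: under the same hypotheses with `λ ≥ 0`, the rung `WeilPositivityOnChar χ t`
of the GRH arm holds — every format-D deposit `(q, χ, t; λ ≥ 0, atoms)` whose dual function `P` is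
nonnegative is a theorem modulo the single real inequality `P ≥ 0`. [folklore] -/
theorem weilPositivityOnChar_of_dual_nonneg (hq : q ≠ 1) (χ : DirichletCharacter ℂ q)
    {t : ℝ} {N : ℕ} (hN : Real.exp (2 * t) ≤ (N : ℝ) + 1) {T : ℚ} (hT : 2 * t ≤ (T : ℝ)) {lam : ℝ}
    (hlam : 0 ≤ lam) {ι : Type*} (s : Finset ι) (A : ι → WeilDualAtom)
    (hA : ∀ i ∈ s, (A i).admissible T = true)
    (hP : ∀ τ : ℝ, 0 ≤ weilFinitePrimeWeightChar χ N τ - lam + ∑ i ∈ s, (A i).eval τ) :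
    WeilPositivityOnChar χ t := fun _ hg hsupp ↦
  (mul_nonneg hlam (weilNorm2Sq_nonneg _)).trans
    (le_re_weilQuadraticChar_of_dual_nonneg hq χ hN hT lam s A hA hP hg hsupp)

/-! ## List forms (the entry points of instance files) -/

/-- A list-sum of atom values is the `Fin`-indexed `Finset` sum. [folklore] -/
theorem list_map_eval_sum_eq (L : List WeilDualAtom) (τ : ℝ) :
    (L.map fun A ↦ A.eval τ).sum = ∑ i : Fin L.length, (L[(i : ℕ)]).eval τ := by
  rw [← List.ofFn_getElem_eq_map, List.sum_ofFn]

/-- **LEMMA D for a certificate given as a LIST of atoms** (admissibility decidable, e.g. `by decide`):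
`λ ‖g‖₂² ≤ Re Q_χ(g)` on `tsupport g ⊆ [-t, t]`. [folklore] -/
theorem le_re_weilQuadraticChar_of_dual_nonneg_list (hq : q ≠ 1) (χ : DirichletCharacter ℂ q)
    {t : ℝ} {N : ℕ} (hN : Real.exp (2 * t) ≤ (N : ℝ) + 1) {T : ℚ} (hT : 2 * t ≤ (T : ℝ)) (lam : ℝ)
    (L : List WeilDualAtom) (hA : ∀ A ∈ L, A.admissible T = true)
    (hP : ∀ τ : ℝ, 0 ≤ weilFinitePrimeWeightChar χ N τ - lam + (L.map fun A ↦ A.eval τ).sum)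
    (hg : IsWeilTest g) (hsupp : tsupport g ⊆ Icc (-t) t) :
    lam * weilNorm2Sq g ≤ (weilQuadraticChar χ g).re :=
  le_re_weilQuadraticChar_of_dual_nonneg hq χ hN hT lam (Finset.univ : Finset (Fin L.length))
    (fun i ↦ L[(i : ℕ)]) (fun i _ ↦ hA _ (List.getElem_mem i.2))
    (fun τ ↦ by simpa [list_map_eval_sum_eq] using hP τ) hg hsupp

/-- **Rung form for a list certificate**: `λ ≥ 0` gives `WeilPositivityOnChar χ t`. [folklore] -/
theorem weilPositivityOnChar_of_dual_nonneg_list (hq : q ≠ 1) (χ : DirichletCharacter ℂ q)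
    {t : ℝ} {N : ℕ} (hN : Real.exp (2 * t) ≤ (N : ℝ) + 1) {T : ℚ} (hT : 2 * t ≤ (T : ℝ)) {lam : ℝ}
    (hlam : 0 ≤ lam) (L : List WeilDualAtom) (hA : ∀ A ∈ L, A.admissible T = true)
    (hP : ∀ τ : ℝ, 0 ≤ weilFinitePrimeWeightChar χ N τ - lam + (L.map fun A ↦ A.eval τ).sum) :
    WeilPositivityOnChar χ t := fun _ hg hsupp ↦
  (mul_nonneg hlam (weilNorm2Sq_nonneg _)).trans
    (le_re_weilQuadraticChar_of_dual_nonneg_list hq χ hN hT lam L hA hP hg hsupp)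

/-! ## Universal (archimedean-only) certificates and transfer inside a key group -/

/-- The ripple sees `χ` only through its values at the prime powers `n ≤ N`: if `χ` (mod `q`) and `χ'`
(mod `q'`) agree at every `n ≤ N` with `Λ(n) ≠ 0`, their ripples coincide. [folklore] -/
theorem weilPrimeRippleChar_congr {q' : ℕ} (χ : DirichletCharacter ℂ q) (χ' : DirichletCharacter ℂ q')
    {N : ℕ} (h : ∀ n ∈ Finset.range (N + 1), (ArithmeticFunction.vonMangoldt n : ℝ) = 0 ∨
      χ (n : ZMod q) = χ' (n : ZMod q')) (τ : ℝ) :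
    weilPrimeRippleChar χ N τ = weilPrimeRippleChar χ' N τ := by
  unfold weilPrimeRippleChar
  refine Finset.sum_congr rfl fun n hn ↦ ?_
  rcases h n hn with h0 | h1
  · rw [h0]; simp
  · rw [h1]

/-- No prime power `n ≤ N` is visible to `χ` (each has `Λ(n) = 0` or `χ(n) = 0`, e.g. `(n, q) > 1`):
the weight is purely archimedean, `M_{χ,N}(τ) = Re ψ(1/4 + a_χ/2 + iτ/2) + log q − log π`. [folklore] -/
theorem weilFinitePrimeWeightChar_eq_arch (χ : DirichletCharacter ℂ q) {N : ℕ}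
    (h : ∀ n ∈ Finset.range (N + 1), (ArithmeticFunction.vonMangoldt n : ℝ) = 0 ∨ χ (n : ZMod q) = 0)
    (τ : ℝ) :
    weilFinitePrimeWeightChar χ N τ =
      (Complex.digamma (1 / 4 + (charParity χ : ℂ) / 2 + τ / 2 * I)).re + (Real.log q - Real.log π) := by
  have h0 : weilPrimeRippleChar χ N τ = 0 := by
    unfold weilPrimeRippleChar
    refine Finset.sum_eq_zero fun n hn ↦ ?_
    rcases h n hn with h0 | h1
    · rw [h0]; simp
    · rw [h1]; simp
  unfold weilFinitePrimeWeightChar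
  rw [h0, sub_zero]

/-- **Transfer inside a key group**: if `χ` mod `q` and `χ'` mod `q'` have the same parity and the same
values at the prime powers `n ≤ N`, then `M_{χ',N} = M_{χ,N} + (log q' − log q)` — a dual certificate
`(λ, atoms)` for `χ` is one for `χ'` with `λ + log q' − log q`. [folklore] -/
theorem weilFinitePrimeWeightChar_transfer {q' : ℕ} (χ : DirichletCharacter ℂ q)
    (χ' : DirichletCharacter ℂ q') (hpar : charParity χ' = charParity χ) {N : ℕ}
    (h : ∀ n ∈ Finset.range (N + 1), (ArithmeticFunction.vonMangoldt n : ℝ) = 0 ∨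
      χ (n : ZMod q) = χ' (n : ZMod q')) (τ : ℝ) :
    weilFinitePrimeWeightChar χ' N τ =
      weilFinitePrimeWeightChar χ N τ + (Real.log q' - Real.log q) := by
  unfold weilFinitePrimeWeightChar
  rw [hpar, weilPrimeRippleChar_congr χ χ' h τ]
  ring

/-- **LEMMA D for UNIVERSAL (archimedean-only) certificates** (list form). A universal certificate of
parity `a` is `(ℓ, atoms)` with `∀ τ, 0 ≤ Re ψ(1/4 + a/2 + iτ/2) − log π − ℓ + Σ atoms(τ)` (no `q`, no `χ`).
For EVERY Dirichlet character `χ` mod `q ≠ 1` of parity `a` to which no prime power `n ≤ N` is visible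
(`e^{2t} ≤ N + 1`) and `0 ≤ ℓ + log q`, the rung `WeilPositivityOnChar χ t` follows. [folklore] -/
theorem weilPositivityOnChar_of_universal_dual_nonneg_list (hq : q ≠ 1) (χ : DirichletCharacter ℂ q)
    {a : ℕ} (ha : charParity χ = a) {t : ℝ} {N : ℕ} (hN : Real.exp (2 * t) ≤ (N : ℝ) + 1)
    (hvis : ∀ n ∈ Finset.range (N + 1), (ArithmeticFunction.vonMangoldt n : ℝ) = 0 ∨ χ (n : ZMod q) = 0)
    {T : ℚ} (hT : 2 * t ≤ (T : ℝ)) {ell : ℝ} (hell : 0 ≤ ell + Real.log q)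
    (L : List WeilDualAtom) (hA : ∀ A ∈ L, A.admissible T = true)
    (hP : ∀ τ : ℝ, 0 ≤ (Complex.digamma (1 / 4 + (a : ℂ) / 2 + τ / 2 * I)).re - Real.log π - ell +
      (L.map fun A ↦ A.eval τ).sum) :
    WeilPositivityOnChar χ t :=
  weilPositivityOnChar_of_dual_nonneg_list hq χ hN hT hell L hA fun τ ↦ by
    rw [weilFinitePrimeWeightChar_eq_arch χ hvis τ, ha]
    have := hP τ
    linarith

/-- **Transfer of a list certificate inside a key group**: a certificate `(λ, atoms, P ≥ 0)` for `χ`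
mod `q` gives `WeilPositivityOnChar χ' t` for every `χ'` mod `q' ≠ 1` with the same parity and the same
values at the prime powers `n ≤ N`, provided `0 ≤ λ + log q' − log q`. [folklore] -/
theorem weilPositivityOnChar_of_dual_nonneg_list_transfer {q' : ℕ} (hq' : q' ≠ 1)
    (χ : DirichletCharacter ℂ q) (χ' : DirichletCharacter ℂ q') (hpar : charParity χ' = charParity χ)
    {t : ℝ} {N : ℕ} (hN : Real.exp (2 * t) ≤ (N : ℝ) + 1)
    (h : ∀ n ∈ Finset.range (N + 1), (ArithmeticFunction.vonMangoldt n : ℝ) = 0 ∨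
      χ (n : ZMod q) = χ' (n : ZMod q'))
    {T : ℚ} (hT : 2 * t ≤ (T : ℝ)) {lam : ℝ} (hlam : 0 ≤ lam + (Real.log q' - Real.log q))
    (L : List WeilDualAtom) (hA : ∀ A ∈ L, A.admissible T = true)
    (hP : ∀ τ : ℝ, 0 ≤ weilFinitePrimeWeightChar χ N τ - lam + (L.map fun A ↦ A.eval τ).sum) :
    WeilPositivityOnChar χ' t :=
  weilPositivityOnChar_of_dual_nonneg_list hq' χ' hN hT hlam L hA fun τ ↦ by
    rw [weilFinitePrimeWeightChar_transfer χ χ' hpar h τ]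
    have := hP τ
    linarith

end Summit.Ventures.WeilGRH

end
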